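import Summits.CriticalPhenomena.CardyFormulaZ2.Theorems.CardySelfDualSegmentUniformMarginalityMixedApproximants

/-!
# Sandwich glue of line `Sketch` (crux `UniformMarginality`, stmt-CriticalPhenomena-5472)

Skeleton v4 of the lead's line reduces the transport kernel (B₂a) `stub_uniformSandwich` (local
uniform RECTILINEAR sandwiches of every conformal rectangle, skeleton v3) to

* the landed GEOMETRY `stub_mixedApproximants` (p114647: rectilinear inner/outer approximants
  `R'`, `R''` of `R`, `ε₀`-close in boundary loop and marks, whose crude crossing events are NESTED
  with that of `R` for all small meshes and all lattice configurations), and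
* the research kernel (B₂a′) DOMAIN CONTINUITY: at every conformal rectangle `R` and `t₀ ∈ [0,1]`
  the crude crossing probability `P_t(Q, δ)` is within `ε` of `P_t(R, δ)` for every rectilinear
  conformal rectangle `Q` that is `ε₀`-close to `R` in boundary loop and marks, UNIFORMLY in the
  mesh `δ < δ₀` and in `|t − t₀| < η₀` (needs `t`-uniform RSW for `M_t` — route crux
  `UniformBoxCrossing`, stmt-CriticalPhenomena-5476 — and boundary three-arm counting).

Proved here: `Pext_mono_of_nested` (nested crude events ⟹ ordered crossing probabilities, since
`M_t` is carried by lattice configurations: `cornerConfig S ⊆ E(ℤ²)`), and the glue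
`stub_uniformSandwichOfDomainContinuity : (B₂a′) → (B₂a)`.
-/

noncomputable section

namespace Summit.CriticalPhenomena.CardyFormulaZ2.Cruxes.UniformMarginality.HeatFlow

open MeasureTheory Literature.Probability.Percolation Literature.Probability.LatticeModels
  Literature.Probability.RandomPlanarGeometry

/-- **Nested crude events give ordered crossing probabilities.** If every lattice configuration
`ω ⊆ E(ℤ²)` crossing `R₁` at mesh `δ` crosses `R₂`, then `P_s(R₁, δ) ≤ P_s(R₂, δ)` for every
parameter `s`: the corner configuration `cornerConfig S` of any coin set `S` lies in `E(ℤ²)`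
(`cornerConfig_subset_edgeSet`), so the coin-space events are nested and `prodBernoulli` is monotone. -/
theorem Pext_mono_of_nested {R₁ R₂ : ConformalRectangle} {δ : ℝ}
    (h : ∀ ω : BondConfig (Site 2), ω ⊆ (zdGraph 2).edgeSet → ω ∈ crossEvent R₁ δ → ω ∈ crossEvent R₂ δ)
    (s : ℝ) : Pext R₁ δ s ≤ Pext R₂ δ s := by
  rw [Pext_eq, Pext_eq]
  refine measureReal_mono (fun S hS => ?_)
  exact h (cornerConfig S) (cornerConfig_subset_edgeSet S) hS

/-- STUB (glue) of skeleton v4 — **uniform sandwiches from domain continuity**: the research kernel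
(B₂a′) DOMAIN CONTINUITY (crude crossing probabilities of `ε₀`-close rectilinear marked domains are
`ε`-close to those of `R`, uniformly in small meshes and in `t` near `t₀`) and the landed geometry
`stub_mixedApproximants` give the local uniform rectilinear sandwiches (B₂a) of skeleton v3:
nesting by `Pext_mono_of_nested`, tightness `P(R'') − P(R') ≤ |P(R'') − P(R)| + |P(R) − P(R')| ≤ ε`. -/
theorem stub_uniformSandwichOfDomainContinuity :
    (∀ (R : ConformalRectangle) (t₀ : ℝ), t₀ ∈ Set.Icc (0 : ℝ) 1 → ∀ ε : ℝ, 0 < ε →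
      ∃ ε₀ > 0, ∃ δ₀ > 0, ∃ η₀ > 0, ∀ Q : ConformalRectangle,
        (∃ S : Finset (ℂ × ℂ), (∀ p ∈ S, p.1.re = p.2.re ∨ p.1.im = p.2.im) ∧
          frontier Q.carrier ⊆ ⋃ p ∈ S, segment ℝ p.1 p.2) →
        (∀ u : ℝ, dist (Q.boundary u) (R.boundary u) ≤ ε₀) → (∀ i : Fin 4, |Q.mark i - R.mark i| ≤ ε₀) →
        ∀ δ : ℝ, 0 < δ → δ < δ₀ → ∀ t ∈ Set.Icc (0 : ℝ) 1, |t - t₀| < η₀ →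
          |Pext Q δ t - Pext R δ t| ≤ ε) →
    (∀ (R : ConformalRectangle) (t₀ : ℝ), t₀ ∈ Set.Icc (0 : ℝ) 1 → ∀ ε : ℝ, 0 < ε →
      ∃ R' R'' : ConformalRectangle,
        (∃ S : Finset (ℂ × ℂ), (∀ p ∈ S, p.1.re = p.2.re ∨ p.1.im = p.2.im) ∧
          frontier R'.carrier ⊆ ⋃ p ∈ S, segment ℝ p.1 p.2) ∧
        (∃ S : Finset (ℂ × ℂ), (∀ p ∈ S, p.1.re = p.2.re ∨ p.1.im = p.2.im) ∧
          frontier R''.carrier ⊆ ⋃ p ∈ S, segment ℝ p.1 p.2) ∧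
        ∃ δ₀ > 0, ∃ η₀ > 0, ∀ δ : ℝ, 0 < δ → δ < δ₀ → ∀ t ∈ Set.Icc (0 : ℝ) 1, |t - t₀| < η₀ →
          Pext R' δ t ≤ Pext R δ t ∧ Pext R δ t ≤ Pext R'' δ t ∧ Pext R'' δ t - Pext R' δ t ≤ ε) := by
  intro hDC R t₀ ht₀ ε hε
  obtain ⟨ε₀, hε₀, δ₀, hδ₀, η₀, hη₀, hclose⟩ := hDC R t₀ ht₀ (ε / 2) (by positivity)
  obtain ⟨R', R'', hS', hS'', hb', hm', hb'', hm'', δ₁, hδ₁, hnest⟩ :=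
    stub_mixedApproximants R ε₀ hε₀
  refine ⟨R', R'', hS', hS'', min δ₀ δ₁, lt_min hδ₀ hδ₁, η₀, hη₀, ?_⟩
  intro δ hδ hδlt t ht htt₀
  have hδ₀' : δ < δ₀ := hδlt.trans_le (min_le_left _ _)
  have hδ₁' : δ < δ₁ := hδlt.trans_le (min_le_right _ _)
  have hlo : Pext R' δ t ≤ Pext R δ t :=
    Pext_mono_of_nested (fun ω hω hωc => (hnest δ hδ hδ₁' ω hω).1 hωc) t
  have hhi : Pext R δ t ≤ Pext R'' δ t :=
    Pext_mono_of_nested (fun ω hω hωc => (hnest δ hδ hδ₁' ω hω).2 hωc) t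
  have h1 := hclose R' hS' hb' hm' δ hδ hδ₀' t ht htt₀
  have h2 := hclose R'' hS'' hb'' hm'' δ hδ hδ₀' t ht htt₀
  refine ⟨hlo, hhi, ?_⟩
  rw [abs_le] at h1 h2
  linarith [h1.1, h2.2]

end Summit.CriticalPhenomena.CardyFormulaZ2.Cruxes.UniformMarginality.HeatFlow

end
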